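import Summits.QuantumFields.BalabanUV.Beta.FP.RoadRebasedHolds
import Summits.QuantumFields.BalabanUV.Beta.FP.StepLawInherit

/-!
# `BalabanUV.Beta.FP.RoadExplicitDefect` — road «FP» for binder row D1: THE ROAD's END WITH THE FIXED-POINT STEP DEFECT MADE EXPLICIT —
# the N2a binders `hfub` (Fubini∞ identity) and `hDA` (summability of the defect) DISCHARGED for the families of record (`d = 3`, `Lc ≥ 2`)

Owner's integration step (road FP owner b2b-balaban-beta-d1-p3, gen 2; OWNER-RULINGS-FP-1 R-FP-5 «take `D m :=` the explicit difference, so `hfub` is `rfl`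
and `hDA` follows from `AbsMoment₂` of the perfect kernels»).  `FP/RoadRebasedHolds` (p221157) reads road FP's END for the pinned family with the families of
record and an ABSTRACT defect family `D` carrying three binders `hfub`, `hDA`, `hSDF`.  Here `D` is INSTANTIATED as leaf-01-g4's explicit difference
`StepDefectInherit.defect TP RP` with
  `TP m := TPerfOf (Lc^m) (KPerf … m) (SPerfOf … S m) (WPerfOf … Wt m)` (the perfect m-fold one-loop kernel) and
  `RP m := (Lc^m)^8 · dressedEntry (colOf (KPerf … m)) (TPerfOf Lc (KPerf …1) (SPerfOf … S 1) (WPerfOf … Wt 1)) ((Lc^m)•·)` (the transported first step),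
so that `hfub` IS `StepDefectInherit.fubini_defect` and `hDA` follows from `AbsMoment₂` of the perfect kernels (class data of the families of record: K-side
`RealRateKMHolds.kernelSide_KPerf_holds`, S/W-side the `m = 1` slot rows + pins and the `m ≥ 2` rebase plugs `RoadRebasedHolds.hSinf_of_rebase`/`hWinf_of_rebase`)
and of the perfect column weights (`StepLawKHolds.entryHyps_perfCol_holds`, read at the zero kernel) — leaf-01-g4's `StepLawInherit.absMoment₂_defect_explicit` pattern.
* §1 `absMoment₂_colOf_KPerf` (the perfect m-fold column is an `AbsMoment₂` weight, every `m ≥ 1`); `absMoment₂_TPerf_one_pinned` / `absMoment₂_TPerf_record`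
  (the perfect kernels of the families of record have absolutely summable second moments, every `m ≥ 1`).
* §2 `absMoment₂_explicitDefect` (`hDA` for the explicit defect), and THE END RE-READ: **`d1Drift_JsBalT2Of_pinned_explicitDefect`** /
  `endpointExistence_JsBalT2Of_pinned_explicitDefect` = `RoadRebasedHolds.d1Drift_JsBalT2Of_pinned_of_rows_rebased` / `endpointExistence_…_rebased` with `D :=` the
  explicit defect, `hfub` and `hDA` DISCHARGED.
RESULT (`2 ≤ Lc`, `r ∈ box (3+1) Lc`, families of record fixed by the pins + rebase equations): `D1Drift Lc (JsBalT2Of …) N μ ν` ⟸ EXACTLY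
{`hRj` (an2's hR; to become `hTsymm` by R-FP-9), `hWj` (an1's hW), **`hSDF` for the EXPLICIT fixed-point defect** (`∀ m ≥ 1, secondMoment (defect TP RP m) μ ν = 0` —
β-additivity of the perfect polarizations; supplier = REBASE-J + two-fold (SDF) via `StepDefectInherit.stepDefect_inherit`, shared), `hasym` (N7)}.
HONEST FRAMING (cell contract, verbatim): «discharging `BetaPertH` makes Bałaban's UV stability UNCONDITIONAL — a real constructive-QFT result; it is NOT the
continuum limit and NOT the Clay problem.»  COMPOSITION over tree theorems; proves no estimate; `hRj`/`hWj`/`hSDF`/`hasym` stay HYPOTHESES (all OPEN); NOT «D1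
closed», NOT BetaPertH, NOT continuum, NOT Clay; 0 wall binders instantiated at a value; binders 0/4 (hW, hR, D1Tel, D1Rep).  [our object], 0 `def`, 0 cite, 0 sorry.
HONEST DEPENDENCY (verbatim): «continuum YM on T⁴ ⇐ BetaPertH ∧ nine spine estimates (0/9 proved); BetaPertH ⇐ (D1) ∧ (D4) ∧ CAP+tail; G-an2-4 gates asym,
D1 and NE2/3/4.»
-/

namespace Summit.QuantumFields.BalabanUV.Beta.FP.RoadExplicitDefect

open Filter Topology
open Literature.MathematicalPhysics.QuantumFieldTheory
open Literature.MathematicalPhysics.QuantumFieldTheory.Balaban1983to89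
open Literature.MathematicalPhysics.QuantumFieldTheory.Balaban1983to89.Beta
open B12Beta (secondMoment)
open B12Normalization (stepBal)
open AffineAveraging (box toSite)
open DecimatedMomentSummable (AbsMoment₂)
open DressedMomentNormalisation (EKer dressedEntry)
open ExpKernelCalculus (MKer Decays VertexFamily₂)
open PolarizationSign (WardTransversal AxisReflectionCovariant)
open OneStepResolventKernel (Fib LocStencil)
open OneStepKernelFamily (KInvStep TbalOf flipK D1Drift)
open BalabanStepJetsSucc (JsBal0Of JsBalOf)
open BalabanStepW2 (WbalOf T2Of T2Of_loc CwOf δwOf δwOf_pos WbalOf_loc₂ JsBalT2Of)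
open AveragingMixedJetTables (vh₂S mixFFAt)
open FlowStep FlowStepRuns DagBinding
open RemainderChain (RemainderConst)
open StepDriftWitness (absMoment₂_comp_zsmul absMoment₂_sub_gen absMoment₂_dressedEntry)
open HessianTelescopingKKT (absMoment₂_const_mul')
open HessKerDressedLimit (locStencil_limStOf vertexFamily₂_limTabOf)
open Summit.QuantumFields.BalabanUV.Beta.HessKerDressedUnits (unitK unitS unitW)
open Summit.QuantumFields.BalabanUV.Beta.MixedJetTablesPlug (hmix_an1)
open Summit.QuantumFields.BalabanUV.Beta.GAN24.CombesThomas (sfStep smStep)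
open Summit.QuantumFields.BalabanUV.Beta.GAN24.StencilSlotOfE3 (one_le_of_two_le)
open Summit.QuantumFields.BalabanUV.Beta.GAN24.StencilSlotSAllThree (hS_hSall_three)
open Summit.QuantumFields.BalabanUV.Beta.GAN24.WSlotT2Tables (hB_base hW_hWall_three_an1_pinned)
open Summit.QuantumFields.BalabanUV.Beta.GAN24.SlotRowsPowBase (SPerfOf_of_eq WPerfOf_of_eq)
open Summit.QuantumFields.BalabanUV.Beta.GAN24.RealRateKMHolds (kernelSide_KPerf_holds)
open Summit.QuantumFields.BalabanUV.Beta.FP.RebaseJets (rebaseS rebaseW)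
open Summit.QuantumFields.BalabanUV.Beta.FP.PerfectObjectsT (KPerf SPerfOf WPerfOf TPerfOf fPerf)
open Summit.QuantumFields.BalabanUV.Beta.FP.TransportInfinityM (colOf)
open Summit.QuantumFields.BalabanUV.Beta.FP.StepLawAssembly (absMoment₂_TPerfOf)
open Summit.QuantumFields.BalabanUV.Beta.FP.StepLawKHolds (entryHyps_perfCol_holds)
open Summit.QuantumFields.BalabanUV.Beta.FP.StepDefectInherit (defect fubini_defect)
open Summit.QuantumFields.BalabanUV.Beta.FP.RoadRebasedHolds (hSinf_of_rebase hWinf_of_rebase d1Drift_JsBalT2Of_pinned_of_rows_rebased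
  endpointExistence_JsBalT2Of_pinned_of_rows_rebased)

noncomputable section

variable {Lc : ℕ} [NeZero Lc] {r : Fin (3 + 1) → ℕ} (hr : r ∈ box (3 + 1) Lc) (cE cVH cΛ cB : ℝ) (Tc : Fin 4 → Fin 4 → Fin 4 → Fin 4 → ℝ)
  (S : ℕ → ℕ → Fin (3 + 1) → (Fin (3 + 1) → ℤ) → MKer (3 + 1) (Fib 3))
  (Wt : ℕ → ℕ → Fin (3 + 1) → (Fin (3 + 1) → ℤ) → Fin (3 + 1) → (Fin (3 + 1) → ℤ) → MKer (3 + 1) (Fib 3))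

/-! ## §1 `AbsMoment₂` of the perfect column and of the perfect kernels of the families of record -/

omit [NeZero Lc] in
/-- **THE PERFECT `m`-FOLD COLUMN IS AN `AbsMoment₂` WEIGHT** (`2 ≤ Lc`, `1 ≤ m`): read off `StepLawKHolds.entryHyps_perfCol_holds` at the zero kernel
(whose admissibility hypotheses are trivial). [our object] -/
theorem absMoment₂_colOf_KPerf [NeZero Lc] (hLc2 : 2 ≤ Lc) {m : ℕ} (hm : 1 ≤ m) (κ l : Fin 4) :
    AbsMoment₂ (colOf (KPerf (d := 3) Lc (sfStep Lc) (smStep 3 Lc) m) κ l) := by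
  have hz : HasSum (fun _ : Fin 4 → ℤ => (0 : ℝ)) 0 := hasSum_zero
  have h0 : ∀ c e : Fin 4, AbsMoment₂ ((0 : EKer 4) c e) := fun c e => by
    unfold AbsMoment₂
    simp only [Pi.zero_apply, abs_zero, mul_zero]
    exact summable_zero
  have hT0 : ∀ c e : Fin 4, HasSum ((0 : EKer 4) c e) 0 := fun c e => by
    simp only [Pi.zero_apply]; exact hz
  have hT1 : ∀ (c e μ : Fin 4), HasSum (fun t : Fin 4 → ℤ => t μ • (0 : EKer 4) c e t) 0 := fun c e μ => by
    simp only [Pi.zero_apply, smul_zero]; exact hz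
  exact (entryHyps_perfCol_holds hLc2 hm h0 hT0 hT1).absW κ l

/-- **`AbsMoment₂` OF THE PERFECT ONE-STEP KERNEL OF THE PINNED FAMILY** (blocking `Lc`; `m = 1` pins + the slot rows of row G-an2-4 BY NAME). [our object] -/
theorem absMoment₂_TPerf_one_pinned (hLc2 : 2 ≤ Lc)
    (hS1 : ∀ j, S j 1 = (JsBal0Of (one_le_of_two_le hLc2) cE cVH cΛ
      (WbalOf 3 Lc cE cVH cΛ (T2Of 3 Lc cE cVH cΛ ((Lc : ℝ) ^ (2 * (3 + 1))) cB Tc (vh₂S 3 Lc) (mixFFAt (toSite r) Lc)) (mixFFAt (toSite r) Lc))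
      (CwOf (one_le_of_two_le hLc2) cE cVH cΛ (T2Of_loc (one_le_of_two_le hLc2) cE cVH cΛ ((Lc : ℝ) ^ (2 * (3 + 1))) cB Tc
        (hB_base (one_le_of_two_le hLc2)) (hmix_an1 (one_le_of_two_le hLc2) hr)) (hmix_an1 (one_le_of_two_le hLc2) hr))
      (δwOf (one_le_of_two_le hLc2) cE cVH cΛ (T2Of_loc (one_le_of_two_le hLc2) cE cVH cΛ ((Lc : ℝ) ^ (2 * (3 + 1))) cB Tc
        (hB_base (one_le_of_two_le hLc2)) (hmix_an1 (one_le_of_two_le hLc2) hr)) (hmix_an1 (one_le_of_two_le hLc2) hr))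
      (δwOf_pos (one_le_of_two_le hLc2) cE cVH cΛ (T2Of_loc (one_le_of_two_le hLc2) cE cVH cΛ ((Lc : ℝ) ^ (2 * (3 + 1))) cB Tc
        (hB_base (one_le_of_two_le hLc2)) (hmix_an1 (one_le_of_two_le hLc2) hr)) (hmix_an1 (one_le_of_two_le hLc2) hr))
      (WbalOf_loc₂ (one_le_of_two_le hLc2) cE cVH cΛ (T2Of_loc (one_le_of_two_le hLc2) cE cVH cΛ ((Lc : ℝ) ^ (2 * (3 + 1))) cB Tc
        (hB_base (one_le_of_two_le hLc2)) (hmix_an1 (one_le_of_two_le hLc2) hr)) (hmix_an1 (one_le_of_two_le hLc2) hr)) j).S)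
    (hW1 : ∀ j, Wt j 1 = WbalOf 3 Lc cE cVH cΛ (T2Of 3 Lc cE cVH cΛ ((Lc : ℝ) ^ (2 * (3 + 1))) cB Tc (vh₂S 3 Lc) (mixFFAt (toSite r) Lc))
      (mixFFAt (toSite r) Lc) j)
    (a b : Fin 4) :
    AbsMoment₂ (TPerfOf Lc (KPerf (d := 3) Lc (sfStep Lc) (smStep 3 Lc) 1) (SPerfOf (sfStep Lc) (smStep 3 Lc) S 1)
      (WPerfOf (sfStep Lc) (smStep 3 Lc) Wt 1) a b) := by
  obtain ⟨⟨δ₀, C₀, hδ₀, -, hK⟩, -, -⟩ := kernelSide_KPerf_holds (Lc := Lc) hLc2 (m := 1) le_rfl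
  obtain ⟨Cs, cS, θS, δS, -, hθS1, hδS, hS, hSall⟩ := hS_hSall_three hLc2 cE cVH cΛ
    (WbalOf 3 Lc cE cVH cΛ (T2Of 3 Lc cE cVH cΛ ((Lc : ℝ) ^ (2 * (3 + 1))) cB Tc (vh₂S 3 Lc) (mixFFAt (toSite r) Lc)) (mixFFAt (toSite r) Lc)) _ _
    (δwOf_pos (one_le_of_two_le hLc2) cE cVH cΛ (T2Of_loc (one_le_of_two_le hLc2) cE cVH cΛ ((Lc : ℝ) ^ (2 * (3 + 1))) cB Tc
        (hB_base (one_le_of_two_le hLc2)) (hmix_an1 (one_le_of_two_le hLc2) hr)) (hmix_an1 (one_le_of_two_le hLc2) hr))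
    (WbalOf_loc₂ (one_le_of_two_le hLc2) cE cVH cΛ (T2Of_loc (one_le_of_two_le hLc2) cE cVH cΛ ((Lc : ℝ) ^ (2 * (3 + 1))) cB Tc
        (hB_base (one_le_of_two_le hLc2)) (hmix_an1 (one_le_of_two_le hLc2) hr)) (hmix_an1 (one_le_of_two_le hLc2) hr))
  obtain ⟨Cw, cW, θW, δW, -, hθW1, hδW, hW, hWall⟩ := hW_hWall_three_an1_pinned hLc2 hr cE cVH cΛ cB Tc
  have hSlim : LocStencil (SPerfOf (sfStep Lc) (smStep 3 Lc) S 1) Cs δS := by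
    rw [SPerfOf_of_eq (sfStep Lc) (smStep 3 Lc) hS1]
    exact locStencil_limStOf hS hSall hθS1
  have hWlim : VertexFamily₂ (WPerfOf (sfStep Lc) (smStep 3 Lc) Wt 1) Lc Cw δW := by
    rw [WPerfOf_of_eq (sfStep Lc) (smStep 3 Lc) hW1]
    exact vertexFamily₂_limTabOf hW hWall hθW1
  exact absMoment₂_TPerfOf hK hδ₀ hSlim hδS hWlim hδW a b

/-- **`AbsMoment₂` OF THE PERFECT `m`-FOLD KERNELS OF THE FAMILIES OF RECORD, EVERY `m ≥ 1`** (blocking `Lc^m`): `m = 1` from the pins and slot rows,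
`m ≥ 2` from the rebase equations (`RoadRebasedHolds.hSinf_of_rebase` / `hWinf_of_rebase`); K-side `kernelSide_KPerf_holds`. [our object] -/
theorem absMoment₂_TPerf_record (hLc2 : 2 ≤ Lc)
    (hS1 : ∀ j, S j 1 = (JsBal0Of (one_le_of_two_le hLc2) cE cVH cΛ
      (WbalOf 3 Lc cE cVH cΛ (T2Of 3 Lc cE cVH cΛ ((Lc : ℝ) ^ (2 * (3 + 1))) cB Tc (vh₂S 3 Lc) (mixFFAt (toSite r) Lc)) (mixFFAt (toSite r) Lc))
      (CwOf (one_le_of_two_le hLc2) cE cVH cΛ (T2Of_loc (one_le_of_two_le hLc2) cE cVH cΛ ((Lc : ℝ) ^ (2 * (3 + 1))) cB Tc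
        (hB_base (one_le_of_two_le hLc2)) (hmix_an1 (one_le_of_two_le hLc2) hr)) (hmix_an1 (one_le_of_two_le hLc2) hr))
      (δwOf (one_le_of_two_le hLc2) cE cVH cΛ (T2Of_loc (one_le_of_two_le hLc2) cE cVH cΛ ((Lc : ℝ) ^ (2 * (3 + 1))) cB Tc
        (hB_base (one_le_of_two_le hLc2)) (hmix_an1 (one_le_of_two_le hLc2) hr)) (hmix_an1 (one_le_of_two_le hLc2) hr))
      (δwOf_pos (one_le_of_two_le hLc2) cE cVH cΛ (T2Of_loc (one_le_of_two_le hLc2) cE cVH cΛ ((Lc : ℝ) ^ (2 * (3 + 1))) cB Tc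
        (hB_base (one_le_of_two_le hLc2)) (hmix_an1 (one_le_of_two_le hLc2) hr)) (hmix_an1 (one_le_of_two_le hLc2) hr))
      (WbalOf_loc₂ (one_le_of_two_le hLc2) cE cVH cΛ (T2Of_loc (one_le_of_two_le hLc2) cE cVH cΛ ((Lc : ℝ) ^ (2 * (3 + 1))) cB Tc
        (hB_base (one_le_of_two_le hLc2)) (hmix_an1 (one_le_of_two_le hLc2) hr)) (hmix_an1 (one_le_of_two_le hLc2) hr)) j).S)
    (hW1 : ∀ j, Wt j 1 = WbalOf 3 Lc cE cVH cΛ (T2Of 3 Lc cE cVH cΛ ((Lc : ℝ) ^ (2 * (3 + 1))) cB Tc (vh₂S 3 Lc) (mixFFAt (toSite r) Lc))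
      (mixFFAt (toSite r) Lc) j)
    (hSm : ∀ m : ℕ, 2 ≤ m → ∃ (W : ℕ → Fin (3 + 1) → (Fin (3 + 1) → ℤ) → Fin (3 + 1) → (Fin (3 + 1) → ℤ) → MKer (3 + 1) (Fib 3))
      (Cw δw : ℕ → ℝ) (hδw : ∀ j, 0 < δw j) (hW' : ∀ j, VertexFamily₂ (W j) (Lc ^ m) (Cw j) (δw j)) (h1 : 1 ≤ Lc ^ m),
      ∀ j, S j m = rebaseS Lc m (fun j' => (JsBal0Of h1 cE cVH cΛ W Cw δw hδw hW' j').S) j)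
    (hWm : ∀ m : ℕ, 2 ≤ m → ∀ j, Wt j m = rebaseW Lc m (WbalOf 3 (Lc ^ m) cE cVH cΛ
      (T2Of 3 (Lc ^ m) cE cVH cΛ (((Lc ^ m : ℕ) : ℝ) ^ (2 * (3 + 1))) cB Tc (vh₂S 3 (Lc ^ m)) (mixFFAt (toSite r) (Lc ^ m)))
      (mixFFAt (toSite r) (Lc ^ m))) j)
    {m : ℕ} (hm : 1 ≤ m) (a b : Fin 4) :
    AbsMoment₂ (TPerfOf (Lc ^ m) (KPerf (d := 3) Lc (sfStep Lc) (smStep 3 Lc) m) (SPerfOf (sfStep Lc) (smStep 3 Lc) S m)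
      (WPerfOf (sfStep Lc) (smStep 3 Lc) Wt m) a b) := by
  obtain ⟨⟨δ₀, C₀, hδ₀, -, hK⟩, -, -⟩ := kernelSide_KPerf_holds (Lc := Lc) hLc2 hm
  rcases (show m = 1 ∨ 2 ≤ m by omega) with h1 | h2
  · subst h1
    obtain ⟨Cs, cS, θS, δS, -, hθS1, hδS, hS, hSall⟩ := hS_hSall_three hLc2 cE cVH cΛ
      (WbalOf 3 Lc cE cVH cΛ (T2Of 3 Lc cE cVH cΛ ((Lc : ℝ) ^ (2 * (3 + 1))) cB Tc (vh₂S 3 Lc) (mixFFAt (toSite r) Lc)) (mixFFAt (toSite r) Lc)) _ _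
      (δwOf_pos (one_le_of_two_le hLc2) cE cVH cΛ (T2Of_loc (one_le_of_two_le hLc2) cE cVH cΛ ((Lc : ℝ) ^ (2 * (3 + 1))) cB Tc
          (hB_base (one_le_of_two_le hLc2)) (hmix_an1 (one_le_of_two_le hLc2) hr)) (hmix_an1 (one_le_of_two_le hLc2) hr))
      (WbalOf_loc₂ (one_le_of_two_le hLc2) cE cVH cΛ (T2Of_loc (one_le_of_two_le hLc2) cE cVH cΛ ((Lc : ℝ) ^ (2 * (3 + 1))) cB Tc
          (hB_base (one_le_of_two_le hLc2)) (hmix_an1 (one_le_of_two_le hLc2) hr)) (hmix_an1 (one_le_of_two_le hLc2) hr))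
    obtain ⟨Cw, cW, θW, δW, -, hθW1, hδW, hW, hWall⟩ := hW_hWall_three_an1_pinned hLc2 hr cE cVH cΛ cB Tc
    have hSlim : LocStencil (SPerfOf (sfStep Lc) (smStep 3 Lc) S 1) Cs δS := by
      rw [SPerfOf_of_eq (sfStep Lc) (smStep 3 Lc) hS1]
      exact locStencil_limStOf hS hSall hθS1
    have hWlim : VertexFamily₂ (WPerfOf (sfStep Lc) (smStep 3 Lc) Wt 1) (Lc ^ 1) Cw δW := by
      rw [WPerfOf_of_eq (sfStep Lc) (smStep 3 Lc) hW1, pow_one]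
      exact vertexFamily₂_limTabOf hW hWall hθW1
    exact absMoment₂_TPerfOf hK hδ₀ hSlim hδS hWlim hδW a b
  · obtain ⟨Cs, δS, hδS, hSlim⟩ := hSinf_of_rebase cE cVH cΛ S hLc2 hSm m h2
    obtain ⟨Cw, δW, hδW, hWlim⟩ := hWinf_of_rebase hr cE cVH cΛ cB Tc Wt hLc2 hWm m h2
    exact absMoment₂_TPerfOf hK hδ₀ hSlim hδS hWlim hδW a b

/-! ## §2 The explicit defect: `hDA`, `hfub`, and the END re-read -/

/-- **`hDA` FOR THE EXPLICIT FIXED-POINT DEFECT** of the families of record (`StepDefectInherit.defect TP RP` with the perfect `m`-fold kernels `TP` and the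
transported first step `RP`): from §1 (leaf-01-g4's `StepLawInherit.absMoment₂_defect_explicit` pattern; no defect majorant, no convergence). [our object] -/
theorem absMoment₂_explicitDefect (hLc2 : 2 ≤ Lc)
    (hS1 : ∀ j, S j 1 = (JsBal0Of (one_le_of_two_le hLc2) cE cVH cΛ
      (WbalOf 3 Lc cE cVH cΛ (T2Of 3 Lc cE cVH cΛ ((Lc : ℝ) ^ (2 * (3 + 1))) cB Tc (vh₂S 3 Lc) (mixFFAt (toSite r) Lc)) (mixFFAt (toSite r) Lc))
      (CwOf (one_le_of_two_le hLc2) cE cVH cΛ (T2Of_loc (one_le_of_two_le hLc2) cE cVH cΛ ((Lc : ℝ) ^ (2 * (3 + 1))) cB Tc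
        (hB_base (one_le_of_two_le hLc2)) (hmix_an1 (one_le_of_two_le hLc2) hr)) (hmix_an1 (one_le_of_two_le hLc2) hr))
      (δwOf (one_le_of_two_le hLc2) cE cVH cΛ (T2Of_loc (one_le_of_two_le hLc2) cE cVH cΛ ((Lc : ℝ) ^ (2 * (3 + 1))) cB Tc
        (hB_base (one_le_of_two_le hLc2)) (hmix_an1 (one_le_of_two_le hLc2) hr)) (hmix_an1 (one_le_of_two_le hLc2) hr))
      (δwOf_pos (one_le_of_two_le hLc2) cE cVH cΛ (T2Of_loc (one_le_of_two_le hLc2) cE cVH cΛ ((Lc : ℝ) ^ (2 * (3 + 1))) cB Tc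
        (hB_base (one_le_of_two_le hLc2)) (hmix_an1 (one_le_of_two_le hLc2) hr)) (hmix_an1 (one_le_of_two_le hLc2) hr))
      (WbalOf_loc₂ (one_le_of_two_le hLc2) cE cVH cΛ (T2Of_loc (one_le_of_two_le hLc2) cE cVH cΛ ((Lc : ℝ) ^ (2 * (3 + 1))) cB Tc
        (hB_base (one_le_of_two_le hLc2)) (hmix_an1 (one_le_of_two_le hLc2) hr)) (hmix_an1 (one_le_of_two_le hLc2) hr)) j).S)
    (hW1 : ∀ j, Wt j 1 = WbalOf 3 Lc cE cVH cΛ (T2Of 3 Lc cE cVH cΛ ((Lc : ℝ) ^ (2 * (3 + 1))) cB Tc (vh₂S 3 Lc) (mixFFAt (toSite r) Lc))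
      (mixFFAt (toSite r) Lc) j)
    (hSm : ∀ m : ℕ, 2 ≤ m → ∃ (W : ℕ → Fin (3 + 1) → (Fin (3 + 1) → ℤ) → Fin (3 + 1) → (Fin (3 + 1) → ℤ) → MKer (3 + 1) (Fib 3))
      (Cw δw : ℕ → ℝ) (hδw : ∀ j, 0 < δw j) (hW' : ∀ j, VertexFamily₂ (W j) (Lc ^ m) (Cw j) (δw j)) (h1 : 1 ≤ Lc ^ m),
      ∀ j, S j m = rebaseS Lc m (fun j' => (JsBal0Of h1 cE cVH cΛ W Cw δw hδw hW' j').S) j)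
    (hWm : ∀ m : ℕ, 2 ≤ m → ∀ j, Wt j m = rebaseW Lc m (WbalOf 3 (Lc ^ m) cE cVH cΛ
      (T2Of 3 (Lc ^ m) cE cVH cΛ (((Lc ^ m : ℕ) : ℝ) ^ (2 * (3 + 1))) cB Tc (vh₂S 3 (Lc ^ m)) (mixFFAt (toSite r) (Lc ^ m)))
      (mixFFAt (toSite r) (Lc ^ m))) j) :
    ∀ m : ℕ, 1 ≤ m → ∀ a b : Fin 4, AbsMoment₂ (defect
      (fun m => TPerfOf (Lc ^ m) (KPerf (d := 3) Lc (sfStep Lc) (smStep 3 Lc) m) (SPerfOf (sfStep Lc) (smStep 3 Lc) S m)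
        (WPerfOf (sfStep Lc) (smStep 3 Lc) Wt m))
      (fun m a b z => ((Lc ^ m : ℕ) : ℝ) ^ 8 * dressedEntry (colOf (KPerf (d := 3) Lc (sfStep Lc) (smStep 3 Lc) m))
        (TPerfOf Lc (KPerf Lc (sfStep Lc) (smStep 3 Lc) 1) (SPerfOf (sfStep Lc) (smStep 3 Lc) S 1) (WPerfOf (sfStep Lc) (smStep 3 Lc) Wt 1))
        (((Lc ^ m : ℕ) : ℤ) • z) a b) m a b) := by
  intro m hm a b
  have hA := fun (m : ℕ) (hm : 1 ≤ m) => absMoment₂_TPerf_record hr cE cVH cΛ cB Tc S Wt hLc2 hS1 hW1 hSm hWm hm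
  have hA1 := absMoment₂_TPerf_one_pinned hr cE cVH cΛ cB Tc S Wt hLc2 hS1 hW1
  have hw := fun κ l => absMoment₂_colOf_KPerf (Lc := Lc) hLc2 hm κ l
  have hN : Lc ^ m ≠ 0 := pow_ne_zero m (NeZero.ne Lc)
  have h1 : AbsMoment₂ (fun y : Fin 4 → ℤ => dressedEntry (colOf (KPerf (d := 3) Lc (sfStep Lc) (smStep 3 Lc) m))
      (TPerfOf Lc (KPerf Lc (sfStep Lc) (smStep 3 Lc) 1) (SPerfOf (sfStep Lc) (smStep 3 Lc) S 1) (WPerfOf (sfStep Lc) (smStep 3 Lc) Wt 1)) y a b) :=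
    absMoment₂_dressedEntry hw hA1 a b
  have h2 := absMoment₂_comp_zsmul hN h1
  have h3 := absMoment₂_const_mul' h2 (((Lc ^ m : ℕ) : ℝ) ^ 8)
  have h4 := absMoment₂_sub_gen (hA (m + 1) (Nat.le_add_left 1 m) a b) h3
  exact absMoment₂_sub_gen h4 (hA m hm a b)

/-- **ROAD «FP», THE END FOR THE PINNED FAMILY WITH THE FAMILIES OF RECORD AND THE EXPLICIT FIXED-POINT DEFECT** (`d = 3`, `2 ≤ Lc`, `r ∈ box (3+1) Lc`):
`D1Drift Lc (JsBalT2Of …) N μ ν` ⟸ EXACTLY the pins + rebase equations (fixing the families), `hRj` (an2's hR), `hWj` (an1's hW), **`hSDF` for the EXPLICIT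
defect** `D m := TP (m+1) − RP m − TP m` (β-additivity of the perfect polarizations), and `hasym` (N7) — `hfub` is `StepDefectInherit.fubini_defect`, `hDA` is §2.
`RoadRebasedHolds.d1Drift_JsBalT2Of_pinned_of_rows_rebased` with `D :=` the explicit defect.  NOT «D1 closed». [our object] -/
theorem d1Drift_JsBalT2Of_pinned_explicitDefect (hLc2 : 2 ≤ Lc)
    (hS1 : ∀ j, S j 1 = (JsBal0Of (one_le_of_two_le hLc2) cE cVH cΛ
      (WbalOf 3 Lc cE cVH cΛ (T2Of 3 Lc cE cVH cΛ ((Lc : ℝ) ^ (2 * (3 + 1))) cB Tc (vh₂S 3 Lc) (mixFFAt (toSite r) Lc)) (mixFFAt (toSite r) Lc))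
      (CwOf (one_le_of_two_le hLc2) cE cVH cΛ (T2Of_loc (one_le_of_two_le hLc2) cE cVH cΛ ((Lc : ℝ) ^ (2 * (3 + 1))) cB Tc
        (hB_base (one_le_of_two_le hLc2)) (hmix_an1 (one_le_of_two_le hLc2) hr)) (hmix_an1 (one_le_of_two_le hLc2) hr))
      (δwOf (one_le_of_two_le hLc2) cE cVH cΛ (T2Of_loc (one_le_of_two_le hLc2) cE cVH cΛ ((Lc : ℝ) ^ (2 * (3 + 1))) cB Tc
        (hB_base (one_le_of_two_le hLc2)) (hmix_an1 (one_le_of_two_le hLc2) hr)) (hmix_an1 (one_le_of_two_le hLc2) hr))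
      (δwOf_pos (one_le_of_two_le hLc2) cE cVH cΛ (T2Of_loc (one_le_of_two_le hLc2) cE cVH cΛ ((Lc : ℝ) ^ (2 * (3 + 1))) cB Tc
        (hB_base (one_le_of_two_le hLc2)) (hmix_an1 (one_le_of_two_le hLc2) hr)) (hmix_an1 (one_le_of_two_le hLc2) hr))
      (WbalOf_loc₂ (one_le_of_two_le hLc2) cE cVH cΛ (T2Of_loc (one_le_of_two_le hLc2) cE cVH cΛ ((Lc : ℝ) ^ (2 * (3 + 1))) cB Tc
        (hB_base (one_le_of_two_le hLc2)) (hmix_an1 (one_le_of_two_le hLc2) hr)) (hmix_an1 (one_le_of_two_le hLc2) hr)) j).S)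
    (hW1 : ∀ j, Wt j 1 = WbalOf 3 Lc cE cVH cΛ (T2Of 3 Lc cE cVH cΛ ((Lc : ℝ) ^ (2 * (3 + 1))) cB Tc (vh₂S 3 Lc) (mixFFAt (toSite r) Lc))
      (mixFFAt (toSite r) Lc) j)
    (hSm : ∀ m : ℕ, 2 ≤ m → ∃ (W : ℕ → Fin (3 + 1) → (Fin (3 + 1) → ℤ) → Fin (3 + 1) → (Fin (3 + 1) → ℤ) → MKer (3 + 1) (Fib 3))
      (Cw δw : ℕ → ℝ) (hδw : ∀ j, 0 < δw j) (hW' : ∀ j, VertexFamily₂ (W j) (Lc ^ m) (Cw j) (δw j)) (h1 : 1 ≤ Lc ^ m),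
      ∀ j, S j m = rebaseS Lc m (fun j' => (JsBal0Of h1 cE cVH cΛ W Cw δw hδw hW' j').S) j)
    (hWm : ∀ m : ℕ, 2 ≤ m → ∀ j, Wt j m = rebaseW Lc m (WbalOf 3 (Lc ^ m) cE cVH cΛ
      (T2Of 3 (Lc ^ m) cE cVH cΛ (((Lc ^ m : ℕ) : ℝ) ^ (2 * (3 + 1))) cB Tc (vh₂S 3 (Lc ^ m)) (mixFFAt (toSite r) (Lc ^ m)))
      (mixFFAt (toSite r) (Lc ^ m))) j)
    (hRj : ∀ j, AxisReflectionCovariant (flipK (TbalOf Lc (JsBalT2Of (one_le_of_two_le hLc2) cE cVH cΛ ((Lc : ℝ) ^ (2 * (3 + 1))) cB Tc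
      (hB_base (one_le_of_two_le hLc2)) (hmix_an1 (one_le_of_two_le hLc2) hr)) j)))
    (hWj : ∀ j, WardTransversal (flipK (TbalOf Lc (JsBalT2Of (one_le_of_two_le hLc2) cE cVH cΛ ((Lc : ℝ) ^ (2 * (3 + 1))) cB Tc
      (hB_base (one_le_of_two_le hLc2)) (hmix_an1 (one_le_of_two_le hLc2) hr)) j)))
    (μ ν : Fin 4)
    (hSDF : ∀ m : ℕ, 1 ≤ m → secondMoment (defect
      (fun m => TPerfOf (Lc ^ m) (KPerf (d := 3) Lc (sfStep Lc) (smStep 3 Lc) m) (SPerfOf (sfStep Lc) (smStep 3 Lc) S m)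
        (WPerfOf (sfStep Lc) (smStep 3 Lc) Wt m))
      (fun m a b z => ((Lc ^ m : ℕ) : ℝ) ^ 8 * dressedEntry (colOf (KPerf (d := 3) Lc (sfStep Lc) (smStep 3 Lc) m))
        (TPerfOf Lc (KPerf Lc (sfStep Lc) (smStep 3 Lc) 1) (SPerfOf (sfStep Lc) (smStep 3 Lc) S 1) (WPerfOf (sfStep Lc) (smStep 3 Lc) Wt 1))
        (((Lc ^ m : ℕ) : ℤ) • z) a b) m) μ ν = 0)
    {N Cg : ℝ} (hasym : ∀ m : ℕ, 1 ≤ m → |fPerf Lc (sfStep Lc) (smStep 3 Lc) S Wt μ ν m - (m : ℝ) * stepBal N Lc| ≤ Cg) :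
    D1Drift Lc (JsBalT2Of (one_le_of_two_le hLc2) cE cVH cΛ ((Lc : ℝ) ^ (2 * (3 + 1))) cB Tc (hB_base (one_le_of_two_le hLc2))
      (hmix_an1 (one_le_of_two_le hLc2) hr)) N μ ν :=
  d1Drift_JsBalT2Of_pinned_of_rows_rebased hr cE cVH cΛ cB Tc S Wt hLc2 hS1 hW1 hSm hWm hRj hWj
    (absMoment₂_explicitDefect hr cE cVH cΛ cB Tc S Wt hLc2 hS1 hW1 hSm hWm)
    (fun m _ a b z => fubini_defect
      (TP := fun m => TPerfOf (Lc ^ m) (KPerf (d := 3) Lc (sfStep Lc) (smStep 3 Lc) m) (SPerfOf (sfStep Lc) (smStep 3 Lc) S m)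
        (WPerfOf (sfStep Lc) (smStep 3 Lc) Wt m))
      (RP := fun m a b z => ((Lc ^ m : ℕ) : ℝ) ^ 8 * dressedEntry (colOf (KPerf (d := 3) Lc (sfStep Lc) (smStep 3 Lc) m))
        (TPerfOf Lc (KPerf Lc (sfStep Lc) (smStep 3 Lc) 1) (SPerfOf (sfStep Lc) (smStep 3 Lc) S 1) (WPerfOf (sfStep Lc) (smStep 3 Lc) Wt 1))
        (((Lc ^ m : ℕ) : ℤ) • z) a b) m a b z)
    μ ν hSDF hasym

/-- **THE CELL's END STATEMENT FROM ROAD «FP», FAMILIES OF RECORD, EXPLICIT DEFECT**: `EndpointExistence Cn` BY TYPE from the pins + rebase equations,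
`hRj`/`hWj` (this family), `hSDF` for the explicit fixed-point defect, bounded-defect asymptotics, `hβ`, (D4) `RemainderConst` with `rr ≤ stepBal`, (C), `hgen` —
`RoadRebasedHolds.endpointExistence_JsBalT2Of_pinned_of_rows_rebased` with `D :=` the explicit defect.  NOT the continuum limit's construction. [our object] -/
theorem endpointExistence_JsBalT2Of_pinned_explicitDefect (hLc2 : 2 ≤ Lc)
    (hS1 : ∀ j, S j 1 = (JsBal0Of (one_le_of_two_le hLc2) cE cVH cΛ
      (WbalOf 3 Lc cE cVH cΛ (T2Of 3 Lc cE cVH cΛ ((Lc : ℝ) ^ (2 * (3 + 1))) cB Tc (vh₂S 3 Lc) (mixFFAt (toSite r) Lc)) (mixFFAt (toSite r) Lc))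
      (CwOf (one_le_of_two_le hLc2) cE cVH cΛ (T2Of_loc (one_le_of_two_le hLc2) cE cVH cΛ ((Lc : ℝ) ^ (2 * (3 + 1))) cB Tc
        (hB_base (one_le_of_two_le hLc2)) (hmix_an1 (one_le_of_two_le hLc2) hr)) (hmix_an1 (one_le_of_two_le hLc2) hr))
      (δwOf (one_le_of_two_le hLc2) cE cVH cΛ (T2Of_loc (one_le_of_two_le hLc2) cE cVH cΛ ((Lc : ℝ) ^ (2 * (3 + 1))) cB Tc
        (hB_base (one_le_of_two_le hLc2)) (hmix_an1 (one_le_of_two_le hLc2) hr)) (hmix_an1 (one_le_of_two_le hLc2) hr))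
      (δwOf_pos (one_le_of_two_le hLc2) cE cVH cΛ (T2Of_loc (one_le_of_two_le hLc2) cE cVH cΛ ((Lc : ℝ) ^ (2 * (3 + 1))) cB Tc
        (hB_base (one_le_of_two_le hLc2)) (hmix_an1 (one_le_of_two_le hLc2) hr)) (hmix_an1 (one_le_of_two_le hLc2) hr))
      (WbalOf_loc₂ (one_le_of_two_le hLc2) cE cVH cΛ (T2Of_loc (one_le_of_two_le hLc2) cE cVH cΛ ((Lc : ℝ) ^ (2 * (3 + 1))) cB Tc
        (hB_base (one_le_of_two_le hLc2)) (hmix_an1 (one_le_of_two_le hLc2) hr)) (hmix_an1 (one_le_of_two_le hLc2) hr)) j).S)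
    (hW1 : ∀ j, Wt j 1 = WbalOf 3 Lc cE cVH cΛ (T2Of 3 Lc cE cVH cΛ ((Lc : ℝ) ^ (2 * (3 + 1))) cB Tc (vh₂S 3 Lc) (mixFFAt (toSite r) Lc))
      (mixFFAt (toSite r) Lc) j)
    (hSm : ∀ m : ℕ, 2 ≤ m → ∃ (W : ℕ → Fin (3 + 1) → (Fin (3 + 1) → ℤ) → Fin (3 + 1) → (Fin (3 + 1) → ℤ) → MKer (3 + 1) (Fib 3))
      (Cw δw : ℕ → ℝ) (hδw : ∀ j, 0 < δw j) (hW' : ∀ j, VertexFamily₂ (W j) (Lc ^ m) (Cw j) (δw j)) (h1 : 1 ≤ Lc ^ m),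
      ∀ j, S j m = rebaseS Lc m (fun j' => (JsBal0Of h1 cE cVH cΛ W Cw δw hδw hW' j').S) j)
    (hWm : ∀ m : ℕ, 2 ≤ m → ∀ j, Wt j m = rebaseW Lc m (WbalOf 3 (Lc ^ m) cE cVH cΛ
      (T2Of 3 (Lc ^ m) cE cVH cΛ (((Lc ^ m : ℕ) : ℝ) ^ (2 * (3 + 1))) cB Tc (vh₂S 3 (Lc ^ m)) (mixFFAt (toSite r) (Lc ^ m)))
      (mixFFAt (toSite r) (Lc ^ m))) j)
    (hRj : ∀ j, AxisReflectionCovariant (flipK (TbalOf Lc (JsBalT2Of (one_le_of_two_le hLc2) cE cVH cΛ ((Lc : ℝ) ^ (2 * (3 + 1))) cB Tc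
      (hB_base (one_le_of_two_le hLc2)) (hmix_an1 (one_le_of_two_le hLc2) hr)) j)))
    (hWj : ∀ j, WardTransversal (flipK (TbalOf Lc (JsBalT2Of (one_le_of_two_le hLc2) cE cVH cΛ ((Lc : ℝ) ^ (2 * (3 + 1))) cB Tc
      (hB_base (one_le_of_two_le hLc2)) (hmix_an1 (one_le_of_two_le hLc2) hr)) j)))
    (μ ν : Fin 4)
    (hSDF : ∀ m : ℕ, 1 ≤ m → secondMoment (defect
      (fun m => TPerfOf (Lc ^ m) (KPerf (d := 3) Lc (sfStep Lc) (smStep 3 Lc) m) (SPerfOf (sfStep Lc) (smStep 3 Lc) S m)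
        (WPerfOf (sfStep Lc) (smStep 3 Lc) Wt m))
      (fun m a b z => ((Lc ^ m : ℕ) : ℝ) ^ 8 * dressedEntry (colOf (KPerf (d := 3) Lc (sfStep Lc) (smStep 3 Lc) m))
        (TPerfOf Lc (KPerf Lc (sfStep Lc) (smStep 3 Lc) 1) (SPerfOf (sfStep Lc) (smStep 3 Lc) S 1) (WPerfOf (sfStep Lc) (smStep 3 Lc) Wt 1))
        (((Lc ^ m : ℕ) : ℤ) • z) a b) m) μ ν = 0)
    {N Cg : ℝ} (hasym : ∀ m : ℕ, 1 ≤ m → |fPerf Lc (sfStep Lc) (smStep 3 Lc) S Wt μ ν m - (m : ℝ) * stepBal N Lc| ≤ Cg)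
    {β : HBeta} {Cn : B12.Construction} (hgen : ForwardGenerated Cn β) (Sβ : B12Beta.OneLoopSplit β)
    (hβ : ∀ j, Sβ.β0 j = B12Beta.secondMoment (TbalOf Lc (JsBalT2Of (one_le_of_two_le hLc2) cE cVH cΛ ((Lc : ℝ) ^ (2 * (3 + 1))) cB Tc
      (hB_base (one_le_of_two_le hLc2)) (hmix_an1 (one_le_of_two_le hLc2) hr)) j) μ ν)
    {rr γ₀ : ℝ} (hγ₀ : 0 < γ₀) (hrem : RemainderConst Sβ γ₀ rr) (hr' : rr ≤ stepBal N Lc) (hcont : BetaContH γ₀ β) :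
    EndpointExistence Cn :=
  endpointExistence_JsBalT2Of_pinned_of_rows_rebased hr cE cVH cΛ cB Tc S Wt hLc2 hS1 hW1 hSm hWm hRj hWj
    (absMoment₂_explicitDefect hr cE cVH cΛ cB Tc S Wt hLc2 hS1 hW1 hSm hWm)
    (fun m _ a b z => fubini_defect
      (TP := fun m => TPerfOf (Lc ^ m) (KPerf (d := 3) Lc (sfStep Lc) (smStep 3 Lc) m) (SPerfOf (sfStep Lc) (smStep 3 Lc) S m)
        (WPerfOf (sfStep Lc) (smStep 3 Lc) Wt m))
      (RP := fun m a b z => ((Lc ^ m : ℕ) : ℝ) ^ 8 * dressedEntry (colOf (KPerf (d := 3) Lc (sfStep Lc) (smStep 3 Lc) m))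
        (TPerfOf Lc (KPerf Lc (sfStep Lc) (smStep 3 Lc) 1) (SPerfOf (sfStep Lc) (smStep 3 Lc) S 1) (WPerfOf (sfStep Lc) (smStep 3 Lc) Wt 1))
        (((Lc ^ m : ℕ) : ℤ) • z) a b) m a b z)
    μ ν hSDF hasym hgen Sβ hβ hγ₀ hrem hr' hcont

end

end Summit.QuantumFields.BalabanUV.Beta.FP.RoadExplicitDefect
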